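import Mathlib
import HarnessLib

/-!
# Route `SpecificationCompactness`, LINE 15 «cocycle_limit» (crux `SpecificationLimitAE`, stmt-QuantumFields-22688) — kernel 1 of STUB B
# `stub_specificationFromCocycle`: FIBRE INTEGRALS CONVERGE IN MEASURE

Generic measure theory on a product `X × G` of two probability spaces `(Π, η)` (no lattice, no group): if non-negative measurable
`R_K → R_∞` IN `(Π ⊗ η)`-MEASURE and the fibres `h ↦ R_K(V,h)` are uniformly integrable in `Π`-probability in the lintegral form of the
line's stub C (`∀ ε ∃ M K₀ ∀ K ≥ K₀, Π{V : ε < ∫⁻ (R_K(V,h) − M)₊ dη} ≤ ε`), then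
* `limit_fibre_tail` — the limit has the same tails (Fatou along an a.e.-convergent subsequence, `Π{ε < liminf} ≤ sup_J Π(⋂_{i≥J} A_i) ≤ ε`);
* `ae_integrable_limit_fibre` — `h ↦ R_∞(V,h)` is `η`-integrable for `Π`-a.e. `V`;
* `tendstoInMeasure_fibreIntegral` — the fibre integrals converge in `Π`-measure: `∫ R_K(V,h) dη(h) → ∫ R_∞(V,h) dη(h)`
  (truncate at `M`: the bounded parts converge in `L¹(Π ⊗ η)` because they converge in measure and are bounded, then Markov/Tonelli on
  the fibres; both tails are `≤ θ` off sets of measure `≤ θ`).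
This is the «Vitali in measure along fibres» step of the planner's STUB-PLAN (ym-idea-5 g10) for the bridge
`stub_specificationFromCocycle`; cell `ym-idea-1` width seat `ym-line-sfw-p2-w3` gen 27 (free hands).  HONEST FRAMING: pure measure
theory; rung R3 RECORD line; no crux, route, rung or mass gap is proved.  Sources: folklore (Vitali / Fatou / Markov); O. Kallenberg,
*Foundations of Modern Probability* (2002), Lemma 4.11 (convergence in measure and subsequences).
-/

noncomputable section

namespace Summit.QuantumFields.YangMills.Theorems.SpecificationCompactnessFibreIntegralInMeasure

open MeasureTheory Filter Topology Function Set
open scoped ENNReal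

/-! ## §1 One fibre: tails in lintegral form, integrability, truncation error -/

section OneFibre

variable {G : Type*} [MeasurableSpace G] (η : Measure G) [IsProbabilityMeasure η]

/-- `ofReal a ≤ ofReal (a − M) + ofReal M`. [folklore] -/
theorem ofReal_le_ofReal_sub_add (a M : ℝ) : ENNReal.ofReal a ≤ ENNReal.ofReal (a - M) + ENNReal.ofReal M := by
  calc ENNReal.ofReal a = ENNReal.ofReal ((a - M) + M) := by ring_nf
    _ ≤ ENNReal.ofReal (a - M) + ENNReal.ofReal M := ENNReal.ofReal_add_le

/-- A non-negative measurable function with a finite lintegral tail `∫⁻ (f − M)₊ < ∞` above some level `M` is integrable (finite measure).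
[folklore] -/
theorem integrable_of_tail_ne_top {f : G → ℝ} (hf : Measurable f) (hf0 : ∀ h, 0 ≤ f h) (M : ℝ)
    (htail : ∫⁻ h, ENNReal.ofReal (f h - M) ∂η ≠ ∞) : Integrable f η := by
  refine (lintegral_ofReal_ne_top_iff_integrable hf.aestronglyMeasurable (ae_of_all _ hf0)).mp ?_
  have h1 : ∫⁻ h, ENNReal.ofReal (f h) ∂η ≤ ∫⁻ h, ENNReal.ofReal (f h - M) ∂η + ENNReal.ofReal (max M 0) := by
    calc ∫⁻ h, ENNReal.ofReal (f h) ∂η ≤ ∫⁻ h, (ENNReal.ofReal (f h - M) + ENNReal.ofReal (max M 0)) ∂η :=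
          lintegral_mono fun h => (ofReal_le_ofReal_sub_add (f h) M).trans
            (add_le_add le_rfl (ENNReal.ofReal_le_ofReal (le_max_left _ _)))
      _ = ∫⁻ h, ENNReal.ofReal (f h - M) ∂η + ENNReal.ofReal (max M 0) := by
          rw [lintegral_add_right _ measurable_const, lintegral_const, measure_univ, mul_one]
  exact ne_top_of_le_ne_top (by simp [htail]) h1

/-- TRUNCATION ERROR: if `∫⁻ (f − M)₊ dη ≤ θ` then `f` is integrable and `0 ≤ ∫ f − ∫ min(f, M) ≤ θ`. [folklore] -/
theorem integral_sub_integral_min_le {f : G → ℝ} (hf : Measurable f) (hf0 : ∀ h, 0 ≤ f h) (M : ℝ) {θ : ℝ} (hθ : 0 ≤ θ)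
    (htail : ∫⁻ h, ENNReal.ofReal (f h - M) ∂η ≤ ENNReal.ofReal θ) :
    Integrable f η ∧ 0 ≤ ∫ h, f h ∂η - ∫ h, min (f h) M ∂η ∧ ∫ h, f h ∂η - ∫ h, min (f h) M ∂η ≤ θ := by
  have hfi : Integrable f η := integrable_of_tail_ne_top η hf hf0 M (ne_top_of_le_ne_top ENNReal.ofReal_ne_top htail)
  have hmin : Integrable (fun h => min (f h) M) η := by
    refine Integrable.of_bound (hf.min measurable_const).aestronglyMeasurable (max |M| 0 + ‖(0:ℝ)‖) ?_
    refine ae_of_all _ fun h => ?_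
    rw [Real.norm_eq_abs, norm_zero, add_zero]
    rcases le_total (f h) M with hle | hle
    · rw [min_eq_left hle, abs_of_nonneg (hf0 h)]
      exact hle.trans ((le_abs_self M).trans (le_max_left _ _))
    · rw [min_eq_right hle]
      exact le_max_left _ _
  -- the positive part `g = f − min f M = max (f − M) 0`, with `ofReal g = ofReal (f − M)`
  have hg : ∀ h, f h - min (f h) M = max (f h - M) 0 := fun h => by
    rcases le_total (f h) M with hle | hle
    · rw [min_eq_left hle, max_eq_right (by linarith), sub_self]
    · rw [min_eq_right hle, max_eq_left (by linarith)]
  have hofReal : ∀ h, ENNReal.ofReal (max (f h - M) 0) = ENNReal.ofReal (f h - M) := fun h => by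
    rcases le_total (f h - M) 0 with hle | hle
    · rw [max_eq_right hle, ENNReal.ofReal_zero, ENNReal.ofReal_of_nonpos hle]
    · rw [max_eq_left hle]
  have hsub : ∫ h, f h ∂η - ∫ h, min (f h) M ∂η = ∫ h, max (f h - M) 0 ∂η := by
    rw [← integral_sub hfi hmin]
    exact integral_congr_ae (ae_of_all _ hg)
  have hgm : Measurable fun h => max (f h - M) 0 := (hf.sub measurable_const).max measurable_const
  have hgint : ∫ h, max (f h - M) 0 ∂η = (∫⁻ h, ENNReal.ofReal (f h - M) ∂η).toReal := by
    rw [integral_eq_lintegral_of_nonneg_ae (f := fun h => max (f h - M) 0)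
      (ae_of_all _ fun h => le_max_right (f h - M) 0) hgm.aestronglyMeasurable]
    congr 1
    exact lintegral_congr_ae (ae_of_all _ hofReal)
  refine ⟨hfi, ?_, ?_⟩
  · rw [hsub]; exact integral_nonneg fun h => le_max_right _ _
  · rw [hsub, hgint]
    exact ENNReal.toReal_le_of_le_ofReal hθ htail

omit [IsProbabilityMeasure η] in
/-- Raising the truncation level can only shrink the tail. [folklore] -/
theorem lintegral_tail_mono {f : G → ℝ} {M M' : ℝ} (hMM' : M ≤ M') :
    ∫⁻ h, ENNReal.ofReal (f h - M') ∂η ≤ ∫⁻ h, ENNReal.ofReal (f h - M) ∂η :=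
  lintegral_mono fun h => ENNReal.ofReal_le_ofReal (by linarith)

end OneFibre

/-! ## §2 The limit inherits the fibre tails; a.e. integrability of the limit fibres -/

section Product

variable {X : Type*} [MeasurableSpace X] (P : Measure X)
  {G : Type*} [MeasurableSpace G] (η : Measure G) [IsProbabilityMeasure η]

/-- **THE LIMIT HAS THE SAME FIBRE TAILS.**  If `R_K → R_∞` in `(Π ⊗ η)`-measure and, for some level `M` and all `K ≥ K₀`,
`Π{V : ε < ∫⁻ (R_K(V,h) − M)₊ dη} ≤ ε`, then `Π{V : ε < ∫⁻ (R_∞(V,h) − M)₊ dη} ≤ ε` (Fatou along an a.e.-convergent subsequence;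
`{ε < liminf a_i} ⊆ ⋃_J ⋂_{i≥J} {ε < a_i}`). [cite: Kallenberg2002, Lemma 4.11] -/
theorem limit_fibre_tail (R : ℕ → X × G → ℝ) (hRm : ∀ K, Measurable (R K)) (Rinf : X × G → ℝ)
    (hlim : TendstoInMeasure (P.prod η) R atTop Rinf) {ε : ℝ≥0∞} {M : ℝ} {K₀ : ℕ}
    (htail : ∀ K, K₀ ≤ K → P {V | ε < ∫⁻ h, ENNReal.ofReal (R K (V, h) - M) ∂η} ≤ ε) :
    P {V | ε < ∫⁻ h, ENNReal.ofReal (Rinf (V, h) - M) ∂η} ≤ ε := by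
  obtain ⟨ns, hns, hae⟩ := hlim.exists_seq_tendsto_ae
  have hV : ∀ᵐ V ∂P, ∀ᵐ h ∂η, Tendsto (fun i => R (ns i) (V, h)) atTop (𝓝 (Rinf (V, h))) :=
    Measure.ae_ae_of_ae_prod hae
  -- Fatou on almost every fibre
  have hFatou : ∀ᵐ V ∂P, ∫⁻ h, ENNReal.ofReal (Rinf (V, h) - M) ∂η ≤
      liminf (fun i => ∫⁻ h, ENNReal.ofReal (R (ns i) (V, h) - M) ∂η) atTop := by
    filter_upwards [hV] with V hVh
    have hmeas : ∀ i, Measurable fun h => ENNReal.ofReal (R (ns i) (V, h) - M) := fun i =>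
      (((hRm _).comp measurable_prodMk_left).sub measurable_const).ennreal_ofReal
    have hcongr : (fun h => ENNReal.ofReal (Rinf (V, h) - M)) =ᵐ[η]
        fun h => liminf (fun i => ENNReal.ofReal (R (ns i) (V, h) - M)) atTop := by
      filter_upwards [hVh] with h hh
      exact ((ENNReal.continuous_ofReal.tendsto _).comp ((hh.sub_const M))).liminf_eq.symm
    rw [lintegral_congr_ae hcongr]
    exact lintegral_liminf_le hmeas
  -- the sets `A i = {ε < a_i}` and `B J = ⋂_{i ≥ J} A i`
  set A : ℕ → Set X := fun i => {V | ε < ∫⁻ h, ENNReal.ofReal (R (ns i) (V, h) - M) ∂η} with hA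
  set B : ℕ → Set X := fun J => ⋂ i, ⋂ (_ : J ≤ i), A i with hB
  have hBmono : Monotone B := by
    intro J J' hJJ' V hV
    simp only [hB, mem_iInter] at hV ⊢
    exact fun i hi => hV i (hJJ'.trans hi)
  have hBle : ∀ J, P (B J) ≤ ε := by
    intro J
    have hsub : B J ⊆ A (max J K₀) := by
      intro V hV
      simp only [hB, mem_iInter] at hV
      exact hV _ (le_max_left _ _)
    refine (measure_mono hsub).trans ?_
    exact htail _ ((le_max_right _ _).trans (hns.id_le _))
  have hcover : ∀ᵐ V ∂P, V ∈ {V | ε < ∫⁻ h, ENNReal.ofReal (Rinf (V, h) - M) ∂η} → V ∈ ⋃ J, B J := by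
    filter_upwards [hFatou] with V hVF hVε
    have hlt : ε < liminf (fun i => ∫⁻ h, ENNReal.ofReal (R (ns i) (V, h) - M) ∂η) atTop := lt_of_lt_of_le hVε hVF
    obtain ⟨J, hJ⟩ := eventually_atTop.mp (eventually_lt_of_lt_liminf hlt)
    simp only [mem_iUnion, hB, mem_iInter]
    exact ⟨J, fun i hi => hJ i hi⟩
  calc P {V | ε < ∫⁻ h, ENNReal.ofReal (Rinf (V, h) - M) ∂η} ≤ P (⋃ J, B J) := measure_mono_ae hcover
    _ = ⨆ J, P (B J) := hBmono.measure_iUnion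
    _ ≤ ε := iSup_le hBle

/-- **THE LIMIT FIBRES ARE INTEGRABLE a.e.**  Under fibre-UI in probability (stub-C form) and convergence in `(Π ⊗ η)`-measure,
`h ↦ R_∞(V,h)` (non-negative, measurable) is `η`-integrable for `Π`-a.e. `V`. [cite: Kallenberg2002, Lemma 4.11] -/
theorem ae_integrable_limit_fibre (R : ℕ → X × G → ℝ) (hRm : ∀ K, Measurable (R K)) (Rinf : X × G → ℝ)
    (hRim : Measurable Rinf) (hRi0 : ∀ z, 0 ≤ Rinf z) (hlim : TendstoInMeasure (P.prod η) R atTop Rinf)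
    (hUI : ∀ ε : ℝ, 0 < ε → ∃ (M : ℝ) (K₀ : ℕ), ∀ K, K₀ ≤ K →
      P {V | ENNReal.ofReal ε < ∫⁻ h, ENNReal.ofReal (R K (V, h) - M) ∂η} ≤ ENNReal.ofReal ε) :
    ∀ᵐ V ∂P, Integrable (fun h => Rinf (V, h)) η := by
  rw [ae_iff]
  -- the bad set has measure ≤ 1/(n+1) for every n
  have hbound : ∀ n : ℕ, P {V | ¬ Integrable (fun h => Rinf (V, h)) η} ≤ ENNReal.ofReal (1 / ((n:ℝ) + 1)) := by
    intro n
    have hε : (0:ℝ) < 1 / ((n:ℝ) + 1) := by positivity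
    obtain ⟨M, K₀, hMK⟩ := hUI _ hε
    have hlimtail := limit_fibre_tail P η R hRm Rinf hlim hMK
    refine le_trans (measure_mono fun V hV => ?_) hlimtail
    -- contrapositive: a finite tail gives integrability
    simp only [mem_setOf_eq] at hV ⊢
    by_contra hle
    push Not at hle
    exact hV (integrable_of_tail_ne_top η (hRim.comp measurable_prodMk_left) (fun h => hRi0 _) M
      (ne_top_of_le_ne_top ENNReal.ofReal_ne_top hle))
  have htend : Tendsto (fun n : ℕ => ENNReal.ofReal (1 / ((n:ℝ) + 1))) atTop (𝓝 0) := by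
    rw [← ENNReal.ofReal_zero]
    exact ENNReal.tendsto_ofReal tendsto_one_div_add_atTop_nhds_zero_nat
  exact le_antisymm (ge_of_tendsto' htend hbound) bot_le

/-! ## §3 The fibre integrals converge in measure -/

/-- Pointwise: `|min(a,M) − min(b,M)| ≤ |a − b|` and `≤ M` for `a, b ≥ 0 ≤ M`. [folklore] -/
theorem abs_min_sub_min_le' {a b M : ℝ} (ha : 0 ≤ a) (hb : 0 ≤ b) (hM : 0 ≤ M) :
    |min a M - min b M| ≤ |a - b| ∧ |min a M - min b M| ≤ M := by
  constructor
  · have h := abs_min_sub_min_le_max a M b M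
    rw [sub_self, abs_zero] at h
    exact h.trans (max_le le_rfl (abs_nonneg _))
  · rw [abs_le]
    constructor
    · have h1 : 0 ≤ min a M := le_min ha hM
      have h2 : min b M ≤ M := min_le_right _ _
      linarith
    · have h1 : min a M ≤ M := min_le_right _ _
      have h2 : 0 ≤ min b M := le_min hb hM
      linarith

/-- **THE BOUNDED PARTS ARE `L¹(P ⊗ η)`-CLOSE**: `∫⁻ |min(R,M) − min(R_∞,M)| ≤ θ + M·(P⊗η){θ ≤ |R − R_∞|}` (`R, R_∞ ≥ 0`, `M ≥ 0`).
[folklore] -/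
theorem lintegral_abs_min_sub_min_le [IsProbabilityMeasure P] (R Rinf : X × G → ℝ) (hRm : Measurable R) (hRim : Measurable Rinf)
    (hR0 : ∀ z, 0 ≤ R z) (hRi0 : ∀ z, 0 ≤ Rinf z) {M : ℝ} (hM : 0 ≤ M) {θ : ℝ} (hθ : 0 < θ) :
    ∫⁻ z, ENNReal.ofReal |min (R z) M - min (Rinf z) M| ∂(P.prod η) ≤
      ENNReal.ofReal θ + ENNReal.ofReal M * (P.prod η) {z | ENNReal.ofReal θ ≤ edist (R z) (Rinf z)} := by
  have hS : MeasurableSet {z : X × G | ENNReal.ofReal θ ≤ edist (R z) (Rinf z)} :=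
    measurableSet_le measurable_const (hRm.edist hRim)
  have hpt : ∀ z, ENNReal.ofReal |min (R z) M - min (Rinf z) M| ≤
      ENNReal.ofReal θ + {z : X × G | ENNReal.ofReal θ ≤ edist (R z) (Rinf z)}.indicator (fun _ => ENNReal.ofReal M) z := by
    intro z
    obtain ⟨h1, h2⟩ := abs_min_sub_min_le' (hR0 z) (hRi0 z) hM
    by_cases hz : z ∈ {z : X × G | ENNReal.ofReal θ ≤ edist (R z) (Rinf z)}
    · rw [indicator_of_mem hz]
      exact (ENNReal.ofReal_le_ofReal h2).trans le_add_self
    · rw [indicator_of_notMem hz, add_zero]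
      simp only [mem_setOf_eq, not_le, edist_dist, Real.dist_eq] at hz
      have h3 : |R z - Rinf z| < θ := (ENNReal.ofReal_lt_ofReal_iff hθ).mp hz
      exact ENNReal.ofReal_le_ofReal (h1.trans h3.le)
  calc ∫⁻ z, ENNReal.ofReal |min (R z) M - min (Rinf z) M| ∂(P.prod η)
      ≤ ∫⁻ z, (ENNReal.ofReal θ + {z : X × G | ENNReal.ofReal θ ≤ edist (R z) (Rinf z)}.indicator
          (fun _ => ENNReal.ofReal M) z) ∂(P.prod η) := lintegral_mono hpt
    _ = ENNReal.ofReal θ + ENNReal.ofReal M * (P.prod η) {z | ENNReal.ofReal θ ≤ edist (R z) (Rinf z)} := by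
        rw [lintegral_add_left measurable_const, lintegral_const, lintegral_indicator_const hS, measure_univ, mul_one]

/-- **FIBRE INTEGRALS CONVERGE IN MEASURE.**  `R_K → R_∞` in `(P ⊗ η)`-measure (all `≥ 0`, measurable) and fibre-UI in
`P`-probability (stub-C form) imply `∫ R_K(V,h) dη(h) → ∫ R_∞(V,h) dη(h)` in `P`-measure.  Proof: truncate at the UI level `M(θ)`:
off three sets of measure `≤ θ` each (bounded parts not `L¹(η)`-close — Markov/Tonelli on the `L¹(P⊗η)` bound; tail of `R_K`; tail of
`R_∞`, by `limit_fibre_tail`) the two fibre integrals differ by `< ε`. [cite: Kallenberg2002, Lemma 4.11] -/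
theorem tendstoInMeasure_fibreIntegral [IsProbabilityMeasure P] (R : ℕ → X × G → ℝ) (hRm : ∀ K, Measurable (R K))
    (hR0 : ∀ K z, 0 ≤ R K z) (Rinf : X × G → ℝ) (hRim : Measurable Rinf) (hRi0 : ∀ z, 0 ≤ Rinf z)
    (hlim : TendstoInMeasure (P.prod η) R atTop Rinf)
    (hUI : ∀ ε : ℝ, 0 < ε → ∃ (M : ℝ) (K₀ : ℕ), ∀ K, K₀ ≤ K →
      P {V | ENNReal.ofReal ε < ∫⁻ h, ENNReal.ofReal (R K (V, h) - M) ∂η} ≤ ENNReal.ofReal ε) :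
    TendstoInMeasure P (fun K V => ∫ h, R K (V, h) ∂η) atTop (fun V => ∫ h, Rinf (V, h) ∂η) := by
  rw [tendstoInMeasure_iff_dist]
  intro ε hε
  rw [ENNReal.tendsto_atTop_zero]
  intro τ hτ
  -- a real tolerance `θ` with `3θ ≤ τ` and `θ ≤ ε/4`
  obtain ⟨θ, hθ, hθε, h3θ⟩ : ∃ θ : ℝ, 0 < θ ∧ θ ≤ ε / 4 ∧ 3 * ENNReal.ofReal θ ≤ τ := by
    rcases eq_or_ne τ ∞ with hτtop | hτtop
    · exact ⟨ε / 4, by positivity, le_rfl, by rw [hτtop]; exact le_top⟩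
    · refine ⟨min (ε / 4) (τ.toReal / 3), lt_min (by positivity)
        (div_pos (ENNReal.toReal_pos hτ.ne' hτtop) (by norm_num)), min_le_left _ _, ?_⟩
      calc 3 * ENNReal.ofReal (min (ε / 4) (τ.toReal / 3)) ≤ 3 * ENNReal.ofReal (τ.toReal / 3) := by
            gcongr; exact min_le_right _ _
        _ = ENNReal.ofReal (3 * (τ.toReal / 3)) := by
            rw [ENNReal.ofReal_mul (by norm_num : (0:ℝ) ≤ 3), ENNReal.ofReal_ofNat]
        _ = ENNReal.ofReal τ.toReal := by ring_nf
        _ ≤ τ := ENNReal.ofReal_toReal_le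
  -- UI level `M ≥ 0` for `θ`, valid from `K₀` on, and for the limit
  obtain ⟨M₀, K₀, hMK₀⟩ := hUI θ hθ
  set M : ℝ := max M₀ 0 with hMdef
  have hM : 0 ≤ M := le_max_right _ _
  have htailK : ∀ K, K₀ ≤ K → P {V | ENNReal.ofReal θ < ∫⁻ h, ENNReal.ofReal (R K (V, h) - M) ∂η} ≤ ENNReal.ofReal θ := by
    intro K hK
    refine le_trans (measure_mono fun V hV => ?_) (hMK₀ K hK)
    exact lt_of_lt_of_le hV (lintegral_tail_mono η (le_max_left _ _))
  have htailinf : P {V | ENNReal.ofReal θ < ∫⁻ h, ENNReal.ofReal (Rinf (V, h) - M) ∂η} ≤ ENNReal.ofReal θ :=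
    limit_fibre_tail P η R hRm Rinf hlim htailK
  -- the bounded parts: `L¹(P⊗η)`-small from `K₁` on
  have hbdd : TendstoInMeasure (P.prod η) R atTop Rinf := hlim
  have hθ' : 0 < ε * θ / 8 := by positivity
  have hsmall : ∀ᶠ K in atTop, ENNReal.ofReal M * (P.prod η) {z | ENNReal.ofReal (ε * θ / 8) ≤ edist (R K z) (Rinf z)} ≤
      ENNReal.ofReal (ε * θ / 8) := by
    have h1 : Tendsto (fun K => ENNReal.ofReal M * (P.prod η) {z | ENNReal.ofReal (ε * θ / 8) ≤ edist (R K z) (Rinf z)})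
        atTop (𝓝 (ENNReal.ofReal M * 0)) :=
      ENNReal.Tendsto.const_mul (hbdd _ (ENNReal.ofReal_pos.mpr hθ')) (Or.inr ENNReal.ofReal_ne_top)
    rw [mul_zero] at h1
    exact eventually_atTop.mpr ((ENNReal.tendsto_atTop_zero.mp h1) _ (ENNReal.ofReal_pos.mpr hθ'))
  obtain ⟨K₁, hK₁⟩ := eventually_atTop.mp hsmall
  refine ⟨max K₀ K₁, fun K hK => ?_⟩
  have hKK₀ : K₀ ≤ K := (le_max_left _ _).trans hK
  have hKK₁ : K₁ ≤ K := (le_max_right _ _).trans hK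
  -- the three bad sets
  set B₁ : Set X := {V | ENNReal.ofReal (ε / 4) ≤ ∫⁻ h, ENNReal.ofReal |min (R K (V, h)) M - min (Rinf (V, h)) M| ∂η} with hB₁
  set B₂ : Set X := {V | ENNReal.ofReal θ < ∫⁻ h, ENNReal.ofReal (R K (V, h) - M) ∂η} with hB₂
  set B₃ : Set X := {V | ENNReal.ofReal θ < ∫⁻ h, ENNReal.ofReal (Rinf (V, h) - M) ∂η} with hB₃
  -- measure of `B₁` by Markov + Tonelli + the `L¹(P⊗η)` bound
  have hdm : Measurable fun z : X × G => ENNReal.ofReal |min (R K z) M - min (Rinf z) M| :=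
    (((hRm K).min measurable_const).sub (hRim.min measurable_const)).abs.ennreal_ofReal
  have hB₁le : P B₁ ≤ ENNReal.ofReal θ := by
    have hL : ∫⁻ V, ∫⁻ h, ENNReal.ofReal |min (R K (V, h)) M - min (Rinf (V, h)) M| ∂η ∂P ≤ ENNReal.ofReal (ε * θ / 4) := by
      rw [← lintegral_prod _ hdm.aemeasurable]
      refine (lintegral_abs_min_sub_min_le P η (R K) Rinf (hRm K) hRim (hR0 K) hRi0 hM hθ').trans ?_
      calc ENNReal.ofReal (ε * θ / 8) + ENNReal.ofReal M * (P.prod η) {z | ENNReal.ofReal (ε * θ / 8) ≤ edist (R K z) (Rinf z)}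
          ≤ ENNReal.ofReal (ε * θ / 8) + ENNReal.ofReal (ε * θ / 8) := by gcongr; exact hK₁ K hKK₁
        _ = ENNReal.ofReal (ε * θ / 4) := by rw [← ENNReal.ofReal_add hθ'.le hθ'.le]; ring_nf
    have hMarkov := mul_meas_ge_le_lintegral₀ (μ := P) (hdm.lintegral_prod_right' (ν := η)).aemeasurable
      (ENNReal.ofReal (ε / 4))
    -- `ofReal (ε/4) * P B₁ ≤ ofReal (ε θ /4) = ofReal (ε/4) * ofReal θ`
    have h2 : ENNReal.ofReal (ε / 4) * P B₁ ≤ ENNReal.ofReal (ε / 4) * ENNReal.ofReal θ := by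
      calc ENNReal.ofReal (ε / 4) * P B₁ ≤ ∫⁻ V, ∫⁻ h, ENNReal.ofReal |min (R K (V, h)) M - min (Rinf (V, h)) M| ∂η ∂P := hMarkov
        _ ≤ ENNReal.ofReal (ε * θ / 4) := hL
        _ = ENNReal.ofReal (ε / 4) * ENNReal.ofReal θ := by rw [← ENNReal.ofReal_mul (by positivity)]; ring_nf
    exact (ENNReal.mul_le_mul_iff_right (ENNReal.ofReal_pos.mpr (by positivity)).ne' ENNReal.ofReal_ne_top).mp h2
  -- on the complement of the three bad sets the fibre integrals are `ε`-close
  have hgood : ∀ V, V ∉ B₁ → V ∉ B₂ → V ∉ B₃ → dist (∫ h, R K (V, h) ∂η) (∫ h, Rinf (V, h) ∂η) < ε := by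
    intro V h1 h2 h3
    simp only [hB₁, hB₂, hB₃, mem_setOf_eq, not_le, not_lt] at h1 h2 h3
    have hRKV : Measurable fun h => R K (V, h) := (hRm K).comp measurable_prodMk_left
    have hRiV : Measurable fun h => Rinf (V, h) := hRim.comp measurable_prodMk_left
    obtain ⟨hintK, hK0, hKθ⟩ := integral_sub_integral_min_le η hRKV (fun h => hR0 K _) M hθ.le h2
    obtain ⟨hinti, hi0, hiθ⟩ := integral_sub_integral_min_le η hRiV (fun h => hRi0 _) M hθ.le h3
    -- the bounded parts
    have hbint : Integrable (fun h => min (R K (V, h)) M - min (Rinf (V, h)) M) η := by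
      refine Integrable.of_bound ((hRKV.min measurable_const).sub (hRiV.min measurable_const)).aestronglyMeasurable M
        (ae_of_all _ fun h => ?_)
      rw [Real.norm_eq_abs]
      exact (abs_min_sub_min_le' (hR0 K _) (hRi0 _) hM).2
    have hmid : |∫ h, min (R K (V, h)) M ∂η - ∫ h, min (Rinf (V, h)) M ∂η| < ε / 4 := by
      have hminK : Integrable (fun h => min (R K (V, h)) M) η := by
        refine Integrable.of_bound (hRKV.min measurable_const).aestronglyMeasurable M (ae_of_all _ fun h => ?_)
        rw [Real.norm_eq_abs, abs_of_nonneg (le_min (hR0 K _) hM)]; exact min_le_right _ _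
      have hmini : Integrable (fun h => min (Rinf (V, h)) M) η := by
        refine Integrable.of_bound (hRiV.min measurable_const).aestronglyMeasurable M (ae_of_all _ fun h => ?_)
        rw [Real.norm_eq_abs, abs_of_nonneg (le_min (hRi0 _) hM)]; exact min_le_right _ _
      rw [← integral_sub hminK hmini]
      calc |∫ h, (min (R K (V, h)) M - min (Rinf (V, h)) M) ∂η|
          ≤ ∫ h, |min (R K (V, h)) M - min (Rinf (V, h)) M| ∂η := by
            have := norm_integral_le_integral_norm (μ := η) (fun h => min (R K (V, h)) M - min (Rinf (V, h)) M)
            simpa only [Real.norm_eq_abs] using this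
        _ = (∫⁻ h, ENNReal.ofReal |min (R K (V, h)) M - min (Rinf (V, h)) M| ∂η).toReal := by
            rw [integral_eq_lintegral_of_nonneg_ae (ae_of_all _ fun h => abs_nonneg _)
              hbint.aestronglyMeasurable.norm]
        _ < ε / 4 := ENNReal.toReal_lt_of_lt_ofReal h1
    rw [Real.dist_eq, abs_lt]
    have hcd := abs_lt.mp hmid
    constructor <;> linarith [hcd.1, hcd.2]
  -- conclusion
  have hsub : {V | ε ≤ dist (∫ h, R K (V, h) ∂η) (∫ h, Rinf (V, h) ∂η)} ⊆ B₁ ∪ B₂ ∪ B₃ := by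
    intro V hV
    by_contra hV'
    simp only [mem_union, not_or] at hV'
    exact absurd (hgood V hV'.1.1 hV'.1.2 hV'.2) (not_lt.mpr hV)
  calc P {V | ε ≤ dist (∫ h, R K (V, h) ∂η) (∫ h, Rinf (V, h) ∂η)} ≤ P (B₁ ∪ B₂ ∪ B₃) := measure_mono hsub
    _ ≤ P B₁ + P B₂ + P B₃ := (measure_union_le _ _).trans (add_le_add (measure_union_le _ _) le_rfl)
    _ ≤ ENNReal.ofReal θ + ENNReal.ofReal θ + ENNReal.ofReal θ := add_le_add (add_le_add hB₁le (htailK K hKK₀)) htailinf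
    _ = 3 * ENNReal.ofReal θ := by ring
    _ ≤ τ := h3θ


end Product

end Summit.QuantumFields.YangMills.Theorems.SpecificationCompactnessFibreIntegralInMeasure

end
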